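import Mathlib.NumberTheory.Height.NumberField
import Mathlib.NumberTheory.Padics.PadicIntegers
import Mathlib.RingTheory.IntegralClosure.IntegrallyClosed
import Mathlib.Analysis.SpecialFunctions.Log.Basic
import HarnessLib

/-!
# The `p`-adic Liouville inequality (fundamental inequality at a `p`-adic embedding)

Everything in this file is **proved**; there are no definitions.  For a number field `K`, a ring
homomorphism `σ : K →+* ℚ_p` (an embedding of `K` into the `p`-adic numbers) and `x ∈ Kˣ`,

* `inv_mulHeight₁_le_norm_embedding` : `H_K(x)⁻¹ ≤ ‖σ x‖_p`,
* `neg_logHeight₁_le_log_norm_embedding` : `-log H_K(x) ≤ log ‖σ x‖_p`,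
* `eq_zero_of_norm_embedding_lt_inv_mulHeight₁` : the contrapositive,

where `H_K = Height.mulHeight₁` and `h_K = Height.logHeight₁` are Mathlib's (relative,
un-normalised) multiplicative and logarithmic heights on `K` (M. Stoll's `Mathlib.NumberTheory.Height`),
i.e. `log H_K(x) = [K : ℚ] · h(x)` with `h` the absolute logarithmic Weil height.  This is the
non-archimedean "Liouville inequality": a nonzero algebraic number cannot be `p`-adically smaller
than the reciprocal of its height (Waldschmidt, *Diophantine Approximation on Linear Algebraic
Groups*, §3.5; the archimedean polynomial form is Lemma 2.10 of Nesterenko–Philippon, LNM 1752,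
Ch. 2).  It is the fourth-step input (lower bound for `|F(q^S)|_p`) of the `p`-adic case of the
Mahler–Manin theorem (Barré-Sirieix–Diaz–Gramain–Philibert 1996), see
`Literature.NumberTheory.Transcendental.MahlerManinPadic`.

## Proof

Elementary, avoiding the identification of `σ` with a finite place of `K`: by
`NumberField.exists_nat_le_mulHeight₁` there is `0 < n ≤ H_K(x⁻¹) = H_K(x)` with `n x⁻¹` an
algebraic integer; algebraic integers of `ℚ_p` lie in `ℤ_p` (`ℤ_p` is integrally closed with
fraction field `ℚ_p`), so `‖n / σ x‖_p ≤ 1`, i.e. `‖σ x‖_p ≥ ‖n‖_p ≥ 1/n ≥ 1/H_K(x)`.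

## References

* M. Waldschmidt, *Diophantine Approximation on Linear Algebraic Groups*, Grundlehren 326,
  Springer 2000, §3.5 (Liouville's inequality).
* [NesterenkoPhilippon2001] Yu. V. Nesterenko, P. Philippon (eds.), LNM 1752, Ch. 2 (G. Diaz),
  Lemma 2.10 (archimedean version), and §2.5 fourth step.
-/

noncomputable section

open Height NumberField

namespace Literature.NumberTheory.Transcendental

variable {p : ℕ} [Fact p.Prime]

/-- An element of `ℚ_p` which is integral over `ℤ` lies in `ℤ_p`, i.e. has norm `≤ 1`
(`ℤ_p` is integrally closed in its fraction field `ℚ_p`). [folklore] -/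
theorem norm_le_one_of_isIntegral {y : ℚ_[p]} (hy : IsIntegral ℤ y) : ‖y‖ ≤ 1 := by
  have hy' : IsIntegral ℤ_[p] y := hy.tower_top
  obtain ⟨z, hz⟩ := (IsIntegrallyClosed.isIntegral_iff (R := ℤ_[p]) (K := ℚ_[p])).mp hy'
  rw [← hz]
  exact z.2

/-- `‖n‖_p ≥ 1/n` for a positive integer `n` (as `p^{v_p(n)} ≤ n`). [folklore] -/
theorem inv_natCast_le_norm_natCast {n : ℕ} (hn : n ≠ 0) : (n : ℝ)⁻¹ ≤ ‖(n : ℚ_[p])‖ := by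
  have hn' : (n : ℚ_[p]) ≠ 0 := Nat.cast_ne_zero.mpr hn
  rw [Padic.norm_eq_zpow_neg_valuation hn', Padic.valuation_natCast, zpow_neg, zpow_natCast]
  have hp : (0 : ℝ) < (p : ℝ) ^ padicValNat p n := by
    have := (Fact.out : p.Prime).pos
    positivity
  exact inv_anti₀ hp (by exact_mod_cast Nat.le_of_dvd (Nat.pos_of_ne_zero hn) pow_padicValNat_dvd)

variable {K : Type*} [Field K] [NumberField K]

/-- **The `p`-adic Liouville inequality.** For a number field `K`, an embedding
`σ : K →+* ℚ_p` and `x ≠ 0` in `K`: `‖σ x‖_p ≥ H_K(x)⁻¹`, where `H_K = Height.mulHeight₁` is the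
multiplicative height of `K` (relative normalisation, `log H_K = [K:ℚ] · h`). [folklore] -/
theorem inv_mulHeight₁_le_norm_embedding (σ : K →+* ℚ_[p]) {x : K} (hx : x ≠ 0) :
    (mulHeight₁ x)⁻¹ ≤ ‖σ x‖ := by
  obtain ⟨n, hn0, hnH, hint⟩ := NumberField.exists_nat_le_mulHeight₁ x⁻¹
  rw [mulHeight₁_inv] at hnH
  have hσx : σ x ≠ 0 := (map_ne_zero σ).mpr hx
  -- `n / σ x` is an algebraic integer of `ℚ_p`, hence of norm `≤ 1`
  have hint' : IsIntegral ℤ (σ (n * x⁻¹)) := hint.map (σ.toIntAlgHom)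
  have h1 : ‖σ (n * x⁻¹)‖ ≤ 1 := norm_le_one_of_isIntegral hint'
  rw [map_mul, map_natCast, map_inv₀, norm_mul, norm_inv,
    mul_inv_le_iff₀ (norm_pos_iff.mpr hσx), one_mul] at h1
  -- chain `H(x)⁻¹ ≤ n⁻¹ ≤ ‖n‖_p ≤ ‖σ x‖_p`
  have hnpos : (0 : ℝ) < n := by exact_mod_cast Nat.pos_of_ne_zero hn0
  calc (mulHeight₁ x)⁻¹ ≤ (n : ℝ)⁻¹ := by
        rw [inv_le_inv₀ (mulHeight₁_pos x) hnpos]; exact hnH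
    _ ≤ ‖(n : ℚ_[p])‖ := inv_natCast_le_norm_natCast hn0
    _ ≤ ‖σ x‖ := h1

/-- **The `p`-adic Liouville inequality, logarithmic form**: `log ‖σ x‖_p ≥ -h_K(x)` for `x ≠ 0`,
with `h_K = Height.logHeight₁ = log H_K`. [folklore] -/
theorem neg_logHeight₁_le_log_norm_embedding (σ : K →+* ℚ_[p]) {x : K} (hx : x ≠ 0) :
    -logHeight₁ x ≤ Real.log ‖σ x‖ := by
  have h := inv_mulHeight₁_le_norm_embedding σ hx
  rw [logHeight₁_eq_log_mulHeight₁, ← Real.log_inv]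
  exact Real.log_le_log (inv_pos.mpr (mulHeight₁_pos x)) h

/-- Contrapositive packaging used in transcendence proofs: a nonzero element of a number field
whose image in `ℚ_p` is smaller than the reciprocal of its height does not exist; i.e. if
`‖σ x‖_p < H_K(x)⁻¹` then `x = 0`. [folklore] -/
theorem eq_zero_of_norm_embedding_lt_inv_mulHeight₁ (σ : K →+* ℚ_[p]) {x : K}
    (h : ‖σ x‖ < (mulHeight₁ x)⁻¹) : x = 0 := by
  by_contra hx
  exact absurd (inv_mulHeight₁_le_norm_embedding σ hx) (not_le.mpr h)

end Literature.NumberTheory.Transcendental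

end
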